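import Mathlib

/-!
# The truncated `p`-adic logarithm as a power map

For an odd prime `p` and `M : ℕ` the integer polynomial
`Λ_M(x) := ((1 + p x) ^ (p ^ M) - 1) / p ^ (M + 1) = ∑_{j < p ^ M} γ M j · x ^ (j + 1)`,
`γ M j = (p ^ M).choose (j + 1) * p ^ (j + 1) / p ^ (M + 1)`, is, in every commutative ring,
a homomorphism from `x ⊕ y = x + y + p x y` to `+` modulo `p ^ M`, injective and surjective
modulo `p ^ M`, compatible with `M ↦ M + 1` and with congruences (clauses (a)–(f) of
`stub_truncatedExpLog`).  The exact identities are first obtained in torsion-free polynomial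
rings over `ℤ` (where powers of `p` can be cancelled) and then specialised by evaluation.
-/

set_option linter.dupNamespace false

namespace Summit.HodgeConjecture.HodgeConjecture.Theorems.FormalLiftingFromClassLifting.WeightOne

open Polynomial

universe u

/-- Exact divisibility behind the coefficients `γ M j`:
`p ^ (M + 1) ∣ (p ^ M).choose (j + 1) * p ^ (j + 1)`. -/
private theorem pow_succ_dvd_choose_mul_pow {p : ℕ} (hp : p.Prime) (M j : ℕ) :
    p ^ (M + 1) ∣ (p ^ M).choose (j + 1) * p ^ (j + 1) := by
  obtain ⟨v, i', hi', hiv⟩ :=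
    Nat.exists_eq_pow_mul_and_not_dvd (Nat.succ_ne_zero j) p hp.one_lt.ne'
  obtain ⟨n, hn⟩ : ∃ n, p ^ M = n + 1 :=
    ⟨p ^ M - 1, by have := Nat.pow_pos (n := M) hp.pos; omega⟩
  have h1 : p ^ M ∣ (p ^ M).choose (j + 1) * p ^ v * i' := by
    rw [mul_assoc, ← hiv, hn]
    exact ⟨_, (Nat.add_one_mul_choose_eq n j).symm⟩
  have h2 : p ^ M ∣ (p ^ M).choose (j + 1) * p ^ v :=
    (Nat.Coprime.pow_left _ ((Nat.Prime.coprime_iff_not_dvd hp).2 hi')).dvd_of_dvd_mul_right h1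
  have hv : v < j + 1 := by
    have hi'pos : 0 < i' := Nat.pos_of_ne_zero (by rintro rfl; exact hi' (dvd_zero p))
    calc v < p ^ v := Nat.lt_pow_self hp.one_lt
      _ ≤ p ^ v * i' := Nat.le_mul_of_pos_right _ hi'pos
      _ = j + 1 := hiv.symm
  obtain ⟨k, hk⟩ : ∃ k, j + 1 = v + (k + 1) := ⟨j - v, by omega⟩
  rw [show p ^ (j + 1) = p ^ v * p ^ (k + 1) by rw [hk, pow_add], ← mul_assoc, pow_succ p M]
  exact mul_dvd_mul h2 (dvd_pow_self p (Nat.succ_ne_zero k))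

/-- Clause (a): `(1 + p x) ^ (p ^ M) = 1 + p ^ (M + 1) Λ_M(x)` in every commutative ring. -/
private theorem clauseA {R : Type*} [CommRing R] {p : ℕ} (hp : p.Prime) (M : ℕ) (x : R) :
    (1 + (p : R) * x) ^ (p ^ M) = 1 + (p : R) ^ (M + 1) *
      ∑ j ∈ Finset.range (p ^ M),
        ((((p ^ M).choose (j + 1) * p ^ (j + 1) / p ^ (M + 1) : ℕ) : ℤ) : R) * x ^ (j + 1) := by
  rw [add_comm (1 : R) ((p : R) * x), add_pow, Finset.sum_range_succ', Finset.mul_sum]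
  simp only [pow_zero, Nat.sub_zero, one_pow, mul_one, Nat.choose_zero_right, Nat.cast_one]
  rw [add_comm]
  congr 1
  refine Finset.sum_congr rfl fun j _ => ?_
  obtain ⟨q, hq⟩ := pow_succ_dvd_choose_mul_pow hp M j
  rw [hq, Nat.mul_div_cancel_left q (Nat.pow_pos hp.pos), Int.cast_natCast]
  have hqR := congrArg (Nat.cast : ℕ → R) hq
  push_cast at hqR
  linear_combination x ^ (j + 1) * hqR

/-- In a domain, clause (a) forces the exact functional equation
`L (X + Y + P X Y) = L X + L Y + P' L X L Y`. -/
private theorem oplus_identity {S : Type*} [CommRing S] [IsDomain S] (P P' : S) (hP' : P' ≠ 0)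
    (n : ℕ) (L : S → S) (ha : ∀ z : S, (1 + P * z) ^ n = 1 + P' * L z) (X Y : S) :
    L (X + Y + P * X * Y) = L X + L Y + P' * (L X * L Y) := by
  have h1 := ha (X + Y + P * X * Y)
  rw [show 1 + P * (X + Y + P * X * Y) = (1 + P * X) * (1 + P * Y) by ring, mul_pow, ha, ha]
    at h1
  refine mul_left_cancel₀ hP' ?_
  linear_combination -h1

/-- Clause (b): `Λ_M (x ⊕ y) ≡ Λ_M x + Λ_M y (mod p ^ M)`; the exact identity holds in the
torsion-free ring `MvPolynomial R ℤ` and is then evaluated at `(x, y)`. -/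
private theorem clauseB {R : Type u} [CommRing R] {p : ℕ} (hp : p.Prime) (M d : ℕ)
    (γ : ℕ → ℤ)
    (ha : ∀ z : MvPolynomial R ℤ, (1 + (p : MvPolynomial R ℤ) * z) ^ (p ^ M) =
      1 + (p : MvPolynomial R ℤ) ^ (M + 1) *
        ∑ j ∈ Finset.range d, (γ j : MvPolynomial R ℤ) * z ^ (j + 1))
    (x y : R) :
    ∃ w : R, (∑ j ∈ Finset.range d, (γ j : R) * (x + y + p * x * y) ^ (j + 1)) =
      (∑ j ∈ Finset.range d, (γ j : R) * x ^ (j + 1)) +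
        (∑ j ∈ Finset.range d, (γ j : R) * y ^ (j + 1)) + (p : R) ^ M * w := by
  have key := oplus_identity (p : MvPolynomial R ℤ) ((p : MvPolynomial R ℤ) ^ (M + 1))
    (pow_ne_zero _ (Nat.cast_ne_zero.2 hp.ne_zero)) (p ^ M)
    (fun z => ∑ j ∈ Finset.range d, (γ j : MvPolynomial R ℤ) * z ^ (j + 1)) ha
    (MvPolynomial.X x) (MvPolynomial.X y)
  have hφ := congrArg (MvPolynomial.eval₂Hom (Int.castRingHom R) id) key
  simp only [map_sum, map_mul, map_pow, map_intCast, map_natCast, map_add,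
    MvPolynomial.eval₂Hom_X', id_eq] at hφ
  exact ⟨p * ((∑ j ∈ Finset.range d, (γ j : R) * x ^ (j + 1)) *
    ∑ j ∈ Finset.range d, (γ j : R) * y ^ (j + 1)), by rw [hφ]; ring⟩

/-- For a prime `p`: `(1 + a) ^ p = 1 + p a + p a² r + a ^ p` for some `r`. -/
private theorem one_add_pow_prime {A : Type*} [CommRing A] {p : ℕ} (hp : p.Prime) (a : A) :
    ∃ r : A, (1 + a) ^ p = 1 + p * a + p * a ^ 2 * r + a ^ p := by
  have h := add_pow_prime_eq hp a 1
  have h1 : (1 : ℕ) ∈ Finset.Ioo 0 p := Finset.mem_Ioo.2 ⟨Nat.one_pos, hp.one_lt⟩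
  rw [← Finset.add_sum_erase _ _ h1] at h
  simp only [one_pow, mul_one, Nat.choose_one_right, Nat.div_self hp.pos, Nat.cast_one,
    pow_zero, Nat.sub_self] at h
  obtain ⟨r, hr⟩ :
      a ∣ ∑ k ∈ (Finset.Ioo 0 p).erase 1, a ^ (k - 1) * ((p.choose k / p : ℕ) : A) := by
    refine Finset.dvd_sum fun k hk => ?_
    have hk1 : k - 1 ≠ 0 := by
      simp only [Finset.mem_erase, Finset.mem_Ioo] at hk
      omega
    exact Dvd.dvd.mul_right (dvd_pow_self a hk1) _
  refine ⟨r, ?_⟩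
  rw [add_comm 1 a, h, hr]
  ring

/-- The step behind clause (e), in a domain `T` in which `p ≠ 0`: if
`(1 + p z) ^ (p ^ M) = 1 + p ^ (M + 1) L` and `(1 + p z) ^ (p ^ (M + 1)) = 1 + p ^ (M + 2) L'`
then `L' = L + p ^ (M + 1) Q` (this uses that `p` is odd). -/
private theorem stepE {T : Type*} [CommRing T] [IsDomain T] {p : ℕ} (hp : p.Prime) (hp2 : p ≠ 2)
    (hpT : (p : T) ≠ 0) (M : ℕ) (z L L' : T)
    (ha : (1 + (p : T) * z) ^ (p ^ M) = 1 + (p : T) ^ (M + 1) * L)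
    (ha' : (1 + (p : T) * z) ^ (p ^ (M + 1)) = 1 + (p : T) ^ (M + 1 + 1) * L') :
    ∃ Q : T, L' = L + (p : T) ^ (M + 1) * Q := by
  obtain ⟨r, hr⟩ := one_add_pow_prime hp ((p : T) ^ (M + 1) * L)
  obtain ⟨k, hk⟩ : ∃ k, p = k + 3 := ⟨p - 3, by have := hp.two_le; omega⟩
  have hsplit : ((p : T) ^ (M + 1) * L) ^ p =
      ((p : T) ^ (M + 1) * L) ^ 3 * ((p : T) ^ (M + 1) * L) ^ k := by
    rw [← pow_add]; congr 1; omega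
  rw [pow_succ, pow_mul, ha, hr, hsplit] at ha'
  refine ⟨L ^ 2 * r + (p : T) ^ M * L ^ 3 * ((p : T) ^ (M + 1) * L) ^ k, ?_⟩
  refine mul_left_cancel₀ (pow_ne_zero (M + 1 + 1) hpT) ?_
  linear_combination -ha'

/-- In a domain `T` with `p ≠ 0`, clause (a) for all `M` gives `L M = z + p K_M`
(induction on `M` using `stepE`, starting from `L 0 = z`). -/
private theorem lam_eq_add {T : Type*} [CommRing T] [IsDomain T] {p : ℕ} (hp : p.Prime)
    (hp2 : p ≠ 2) (hpT : (p : T) ≠ 0) (z : T) (L : ℕ → T)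
    (ha : ∀ M, (1 + (p : T) * z) ^ (p ^ M) = 1 + (p : T) ^ (M + 1) * L M) (M : ℕ) :
    ∃ K : T, L M = z + p * K := by
  induction M with
  | zero =>
    refine ⟨0, ?_⟩
    have h := ha 0
    simp only [pow_zero, pow_one, zero_add] at h
    rw [mul_zero, add_zero]
    exact (mul_left_cancel₀ hpT (add_left_cancel h)).symm
  | succ M ih =>
    obtain ⟨K, hK⟩ := ih
    obtain ⟨Q, hQ⟩ := stepE hp hp2 hpT M z (L M) (L (M + 1)) (ha M) (ha (M + 1))
    exact ⟨K + (p : T) ^ M * Q, by rw [hQ, hK]; ring⟩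

/-- Evaluation of `Λ = ∑ γ j X ^ (j + 1) ∈ ℤ[X]` at `t : R`. -/
private theorem eval₂_lam {R : Type*} [CommRing R] (d : ℕ) (γ : ℕ → ℤ) (t : R) :
    Polynomial.eval₂RingHom (Int.castRingHom R) t
        (∑ j ∈ Finset.range d, (γ j : ℤ[X]) * X ^ (j + 1)) =
      ∑ j ∈ Finset.range d, (γ j : R) * t ^ (j + 1) := by
  simp only [map_sum, map_mul, map_pow, map_intCast]
  simp only [Polynomial.coe_eval₂RingHom, Polynomial.eval₂_X]

/-- `Λ_M (x + e) = Λ_M x + e + p e q`: `Λ_M ≡ X (mod p)` coefficientwise, from `lam_eq_add`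
in `ℤ[X]`, then evaluated. -/
private theorem lam_add {R : Type*} [CommRing R] {p : ℕ} (hp : p.Prime) (hp2 : p ≠ 2)
    (d : ℕ → ℕ) (γ : ℕ → ℕ → ℤ)
    (ha : ∀ M : ℕ, (1 + (p : ℤ[X]) * X) ^ (p ^ M) =
      1 + (p : ℤ[X]) ^ (M + 1) * ∑ j ∈ Finset.range (d M), (γ M j : ℤ[X]) * X ^ (j + 1))
    (M : ℕ) (x e : R) :
    ∃ q : R, (∑ j ∈ Finset.range (d M), (γ M j : R) * (x + e) ^ (j + 1)) =
      (∑ j ∈ Finset.range (d M), (γ M j : R) * x ^ (j + 1)) + e + p * e * q := by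
  obtain ⟨K, hK⟩ := lam_eq_add hp hp2 (Nat.cast_ne_zero.2 hp.ne_zero) (X : ℤ[X])
    (fun M => ∑ j ∈ Finset.range (d M), (γ M j : ℤ[X]) * X ^ (j + 1)) ha M
  have hev : ∀ t : R, (∑ j ∈ Finset.range (d M), (γ M j : R) * t ^ (j + 1)) =
      t + p * (K.map (Int.castRingHom R)).eval t := by
    intro t
    have h := congrArg (Polynomial.eval₂RingHom (Int.castRingHom R) t) hK
    rw [eval₂_lam, map_add, map_mul, map_natCast] at h
    rw [h, Polynomial.eval_map, Polynomial.coe_eval₂RingHom, Polynomial.eval₂_X]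
  obtain ⟨c, hc⟩ := Polynomial.sub_dvd_eval_sub (x + e) x (K.map (Int.castRingHom R))
  rw [add_sub_cancel_left] at hc
  exact ⟨c, by rw [hev, hev]; linear_combination (p : R) * hc⟩

/-- Clause (e): `Λ_{M+1} x ≡ Λ_M x (mod p ^ (M + 1))`, from `stepE` in `ℤ[X]`,
then evaluated. -/
private theorem clauseE {R : Type*} [CommRing R] {p : ℕ} (hp : p.Prime) (hp2 : p ≠ 2)
    (d : ℕ → ℕ) (γ : ℕ → ℕ → ℤ)
    (ha : ∀ M : ℕ, (1 + (p : ℤ[X]) * X) ^ (p ^ M) =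
      1 + (p : ℤ[X]) ^ (M + 1) * ∑ j ∈ Finset.range (d M), (γ M j : ℤ[X]) * X ^ (j + 1))
    (M : ℕ) (x : R) :
    ∃ w : R, (∑ j ∈ Finset.range (d (M + 1)), (γ (M + 1) j : R) * x ^ (j + 1)) =
      (∑ j ∈ Finset.range (d M), (γ M j : R) * x ^ (j + 1)) + (p : R) ^ (M + 1) * w := by
  obtain ⟨Q, hQ⟩ := stepE hp hp2 (Nat.cast_ne_zero.2 hp.ne_zero) M (X : ℤ[X]) _ _ (ha M)
    (ha (M + 1))
  have h := congrArg (Polynomial.eval₂RingHom (Int.castRingHom R) x) hQ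
  rw [eval₂_lam, map_add, eval₂_lam, map_mul, map_pow, map_natCast] at h
  exact ⟨_, h⟩

/-- Clause (f) for any map `f` with `f (x + e) = f x + e + p e q`. -/
private theorem clauseF_of {R : Type*} [CommRing R] (P : R) (M : ℕ) (f : R → R)
    (hf : ∀ x e : R, ∃ q : R, f (x + e) = f x + e + P * e * q) (x w : R) :
    ∃ w' : R, f (x + P ^ M * w) = f x + P ^ M * w' := by
  obtain ⟨q, hq⟩ := hf x (P ^ M * w)
  exact ⟨w + P * w * q, by rw [hq]; ring⟩

/-- Clause (c) (injectivity modulo `P ^ M`) for any map `f` with `f (x + e) = f x + e + P e q`: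
`1 + P q` is inverted modulo `P ^ M` by a geometric sum. -/
private theorem clauseC_of {R : Type*} [CommRing R] (P : R) (M : ℕ) (f : R → R)
    (hf : ∀ x e : R, ∃ q : R, f (x + e) = f x + e + P * e * q) (x x' : R)
    (h : ∃ w : R, f x' = f x + P ^ M * w) : ∃ w : R, x' = x + P ^ M * w := by
  obtain ⟨w, hw⟩ := h
  obtain ⟨q, hq⟩ := hf x (x' - x)
  rw [add_sub_cancel] at hq
  have hgeom := mul_neg_geom_sum (-(P * q)) M
  obtain ⟨t, ht⟩ : P ^ M ∣ (-(P * q)) ^ M :=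
    pow_dvd_pow_of_dvd (dvd_neg.2 (dvd_mul_right P q)) M
  rw [ht] at hgeom
  refine ⟨w * (∑ i ∈ Finset.range M, (-(P * q)) ^ i) + (x' - x) * t, ?_⟩
  linear_combination -(x' - x) * hgeom - (∑ i ∈ Finset.range M, (-(P * q)) ^ i) * (hq - hw)

/-- Clause (d) (surjectivity modulo `P ^ M`) for any map `f` with `f (x + e) = f x + e + P e q`,
by Newton iteration. -/
private theorem clauseD_of {R : Type*} [CommRing R] (P : R) (f : R → R)
    (hf : ∀ x e : R, ∃ q : R, f (x + e) = f x + e + P * e * q) (y : R) :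
    ∀ M : ℕ, ∃ x w : R, f x = y + P ^ M * w
  | 0 => ⟨y, f y - y, by ring⟩
  | M + 1 => by
    obtain ⟨x, w, h⟩ := clauseD_of P f hf y M
    obtain ⟨q, hq⟩ := hf x (-(P ^ M * w))
    exact ⟨x + -(P ^ M * w), -(w * q), by rw [hq, h]; ring⟩

/-- Clauses (c), (d), (f) for any map `f` with `f (x + e) = f x + e + P e q`. -/
private theorem clausesCDF_of {R : Type*} [CommRing R] (P : R) (M : ℕ) (f : R → R)
    (hf : ∀ x e : R, ∃ q : R, f (x + e) = f x + e + P * e * q) :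
    (∀ x x' : R, (∃ w : R, f x' = f x + P ^ M * w) → ∃ w : R, x' = x + P ^ M * w) ∧
    (∀ y : R, ∃ x w : R, f x = y + P ^ M * w) ∧
    (∀ x w : R, ∃ w' : R, f (x + P ^ M * w) = f x + P ^ M * w') :=
  ⟨clauseC_of P M f hf, fun y => clauseD_of P f hf y M, clauseF_of P M f hf⟩

/-- **Truncated `p`-adic logarithm via the power map.** For an odd prime `p` there are
`d : ℕ → ℕ` and integer coefficients `γ` such that
`Λ_M(x) = ∑_{j < d M} γ M j x ^ (j + 1)`
satisfies, in every commutative ring `R`: (a) `(1 + p x) ^ (p ^ M) = 1 + p ^ (M + 1) Λ_M(x)`;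
(b) `Λ_M(x + y + p x y) ≡ Λ_M x + Λ_M y (mod p ^ M)`; (c) `Λ_M` is injective modulo `p ^ M`;
(d) `Λ_M` is surjective modulo `p ^ M`; (e) `Λ_{M+1} ≡ Λ_M (mod p ^ (M + 1))`;
(f) `Λ_M` respects congruences modulo `p ^ M`. -/
theorem stub_truncatedExpLog :
    ∀ (p : ℕ), p.Prime → p ≠ 2 → ∃ (d : ℕ → ℕ) (γ : ℕ → ℕ → ℤ),
      ∀ (R : Type u) [CommRing R] (M : ℕ),
        (∀ x : R, (1 + p * x) ^ (p ^ M) =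
          1 + (p : R) ^ (M + 1) * ∑ j ∈ Finset.range (d M), (γ M j : R) * x ^ (j + 1)) ∧
        (∀ x y : R, ∃ w : R,
          (∑ j ∈ Finset.range (d M), (γ M j : R) * (x + y + p * x * y) ^ (j + 1)) =
            (∑ j ∈ Finset.range (d M), (γ M j : R) * x ^ (j + 1)) +
              (∑ j ∈ Finset.range (d M), (γ M j : R) * y ^ (j + 1)) + (p : R) ^ M * w) ∧
        (∀ x x' : R,
          (∃ w : R, (∑ j ∈ Finset.range (d M), (γ M j : R) * x' ^ (j + 1)) =
            (∑ j ∈ Finset.range (d M), (γ M j : R) * x ^ (j + 1)) + (p : R) ^ M * w) →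
          ∃ w : R, x' = x + (p : R) ^ M * w) ∧
        (∀ y : R, ∃ x w : R,
          (∑ j ∈ Finset.range (d M), (γ M j : R) * x ^ (j + 1)) = y + (p : R) ^ M * w) ∧
        (∀ x : R, ∃ w : R,
          (∑ j ∈ Finset.range (d (M + 1)), (γ (M + 1) j : R) * x ^ (j + 1)) =
            (∑ j ∈ Finset.range (d M), (γ M j : R) * x ^ (j + 1)) + (p : R) ^ (M + 1) * w) ∧
        (∀ x w : R, ∃ w' : R,
          (∑ j ∈ Finset.range (d M), (γ M j : R) * (x + (p : R) ^ M * w) ^ (j + 1)) =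
            (∑ j ∈ Finset.range (d M), (γ M j : R) * x ^ (j + 1)) + (p : R) ^ M * w') := by
  intro p hp hp2
  refine ⟨fun M => p ^ M,
    fun M j => (((p ^ M).choose (j + 1) * p ^ (j + 1) / p ^ (M + 1) : ℕ) : ℤ), ?_⟩
  intro R _ M
  have haX : ∀ M : ℕ, (1 + (p : ℤ[X]) * X) ^ (p ^ M) = 1 + (p : ℤ[X]) ^ (M + 1) *
      ∑ j ∈ Finset.range (p ^ M),
        ((((p ^ M).choose (j + 1) * p ^ (j + 1) / p ^ (M + 1) : ℕ) : ℤ) : ℤ[X]) *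
          X ^ (j + 1) :=
    fun M => clauseA hp M X
  have hP1 := lam_add (R := R) hp hp2 (fun M => p ^ M)
    (fun M j => (((p ^ M).choose (j + 1) * p ^ (j + 1) / p ^ (M + 1) : ℕ) : ℤ)) haX M
  obtain ⟨hC, hD, hF⟩ := clausesCDF_of (p : R) M (fun t => ∑ j ∈ Finset.range (p ^ M),
    ((((p ^ M).choose (j + 1) * p ^ (j + 1) / p ^ (M + 1) : ℕ) : ℤ) : R) * t ^ (j + 1)) hP1
  refine ⟨fun x => clauseA hp M x, fun x y => clauseB hp M _ _ (fun z => clauseA hp M z) x y,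
    hC, hD, fun x => clauseE hp hp2 (fun M => p ^ M)
      (fun M j => (((p ^ M).choose (j + 1) * p ^ (j + 1) / p ^ (M + 1) : ℕ) : ℤ)) haX M x, hF⟩

end Summit.HodgeConjecture.HodgeConjecture.Theorems.FormalLiftingFromClassLifting.WeightOne
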